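import Summits.Ventures.HodgeRepro2.T5SU11KFiniteMajorantPow
import Summits.Ventures.HodgeRepro2.T5SU11OrbitMeasure

/-!
# The Jacobi transform as a function of the WEIGHT: antitone, log-convex (Hölder), and `→ 0`

For fixed `λ` the Jacobi transform `m̂_k(λ) = ∫_G (1 − |g·0|²)^{k/2} φ_λ(g) dν` of `T5SU11JacobiTransform`
is defined on the ray `k > max(1, λ, 2 − λ)`; as a function of the weight `k` it is a Laplace transform
`∫_G e^{−k s(g)} φ_λ(g) dν` with the non-negative phase `s(g) = log|a(g)|` (`orbit_rpow_eq_exp`), and this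
file records the three properties that every such transform of a positive measure has:

* **antitone in `k`** (`antitoneOn_jacobi_weight`) — the bases `1 − |g·0|² ∈ (0, 1]` — and STRICTLY so
  (`strictAntiOn_jacobi_weight`): the difference of the integrands is positive on the open set
  `{g·0 ≠ 0}`, of positive Haar measure;
* **log-convex in `k`** (`convexOn_log_jacobi_weight`): Hölder's inequality with the exponents
  `1/a, 1/b`, `a + b = 1`, applied to `(m_{k₁} φ_λ)^a · (m_{k₂} φ_λ)^b = m_{a k₁ + b k₂} φ_λ`
  (`jacobi_mul_add_mul_le`: `m̂_{a k₁ + b k₂} ≤ m̂_{k₁}^a m̂_{k₂}^b`), the same argument as Mathlib's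
  Bohr–Mollerup log-convexity of `Γ`;
* **`m̂_k(λ) → 0` as `k → ∞`** (`tendsto_jacobi_weight_atTop_zero`): dominated convergence, the integrands
  tending to `0` off the rotation subgroup `K = {g·0 = 0}`, which is `ν`-NULL (`nu_orbit_eq_zero`: the
  orbit map pushes `ν` to a multiple of the Poincaré measure, `T5SU11OrbitMeasure.map_orbit_nu`, and the
  Poincaré measure has no atoms) — `orbit_ne_zero_ae`.

Nothing is claimed about (N).

Blind lane: Mathlib + the HodgeRepro2 prefix only; no sorry; axioms ⊆ {propext, Classical.choice,
Quot.sound}.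
-/

namespace Summit.Ventures.HodgeRepro2.T5SU11JacobiWeight

open MeasureTheory MeasureTheory.Measure Metric Set Filter Topology
open T5SU11Unimodular T5SU11Fibration T5SU11Cartan T5HaarCircle T5BergmanCoefficient
  T5SU11FibrationHaar T5SU11SphericalFunction T5SU11SphericalSymmetry T5SU11SphericalBounds
  T5SU11SphericalContinuous T5SU11JacobiIwasawa T5SU11JacobiTransform
  T5SU11KFiniteMajorantPow T5SU11OrbitMeasure T5PoincareMeasure
open scoped Real ENNReal

/-! ### Pointwise: the Laplace form and the monotonicity of the integrand in `k` -/

/-- `1 − |g·0|² ≤ 1`. -/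
lemma one_sub_norm_orbit_sq_le_one (g : SU11) : 1 - ‖orbit g‖ ^ 2 ≤ 1 := by
  have := sq_nonneg ‖orbit g‖
  linarith

/-- `0 < |a(g)|` (from `1 − |g·0|² = |a(g)|⁻²`). -/
lemma norm_mat_pos (g : SU11) : 0 < ‖mat g 0 0‖ := by
  have hp := one_sub_norm_orbit_sq_pos g
  rw [one_sub_norm_orbit_sq] at hp
  rcases (norm_nonneg (mat g 0 0)).lt_or_eq with h | h
  · exact h
  · rw [← h, inv_zero] at hp
    simp at hp

/-- `1 ≤ |a(g)|`. -/
lemma one_le_norm_mat (g : SU11) : 1 ≤ ‖mat g 0 0‖ := by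
  have h1 := one_sub_norm_orbit_sq_le_one g
  rw [one_sub_norm_orbit_sq] at h1
  have hpos := norm_mat_pos g
  have hinv : ‖mat g 0 0‖⁻¹ ≤ 1 := by
    by_contra hc
    have hc' : 1 < ‖mat g 0 0‖⁻¹ := not_le.mp hc
    nlinarith
  exact (inv_le_one₀ hpos).mp hinv

/-- **The Laplace form**: `(1 − |g·0|²)^{k/2} = exp(−k · log|a(g)|)` — the coefficient modulus is
`e^{−k s(g)}` with the phase `s(g) = log|a(g)| ≥ 0`. -/
theorem orbit_rpow_eq_exp (k : ℝ) (g : SU11) :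
    (1 - ‖orbit g‖ ^ 2) ^ (k / 2) = Real.exp (-(k * Real.log ‖mat g 0 0‖)) := by
  have ha : 0 < ‖mat g 0 0‖ := norm_mat_pos g
  rw [one_sub_norm_orbit_sq, ← Real.rpow_two, ← Real.rpow_mul (inv_nonneg.mpr ha.le),
    Real.rpow_def_of_pos (inv_pos.mpr ha), Real.log_inv]
  congr 1
  ring

/-- The phase `log|a(g)|` is non-negative (`|a(g)| ≥ 1`). -/
theorem log_norm_mat_nonneg (g : SU11) : 0 ≤ Real.log ‖mat g 0 0‖ :=
  Real.log_nonneg (one_le_norm_mat g)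

/-- `k₁ ≤ k₂ ⇒ m_{k₂}(g) ≤ m_{k₁}(g)`: the integrand is antitone in the weight. -/
theorem orbit_rpow_antitone {k₁ k₂ : ℝ} (h : k₁ ≤ k₂) (g : SU11) :
    (1 - ‖orbit g‖ ^ 2) ^ (k₂ / 2) ≤ (1 - ‖orbit g‖ ^ 2) ^ (k₁ / 2) :=
  Real.rpow_le_rpow_of_exponent_ge (one_sub_norm_orbit_sq_pos g) (one_sub_norm_orbit_sq_le_one g)
    (by linarith)

/-- `k₁ < k₂` and `g·0 ≠ 0 ⇒ m_{k₂}(g) < m_{k₁}(g)`. -/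
theorem orbit_rpow_strictAnti {k₁ k₂ : ℝ} (h : k₁ < k₂) {g : SU11} (hg : orbit g ≠ 0) :
    (1 - ‖orbit g‖ ^ 2) ^ (k₂ / 2) < (1 - ‖orbit g‖ ^ 2) ^ (k₁ / 2) := by
  have hlt : 1 - ‖orbit g‖ ^ 2 < 1 := by
    have := norm_pos_iff.mpr hg
    nlinarith
  exact Real.rpow_lt_rpow_of_exponent_gt (one_sub_norm_orbit_sq_pos g) hlt (by linarith)

section measure

variable [MeasurableSpace Circle] [BorelSpace Circle]

/-! ### The rotation subgroup is a null set -/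

/-- **`K = {g·0 = 0}` is `ν`-null**: `ν {g | g·0 = 0} = 0` (the orbit map pushes `ν` to
`μ_K(K) • poincare`, and the Poincaré measure has no atoms). -/
theorem nu_orbit_eq_zero : nu haarCircle {g : SU11 | orbit g = 0} = 0 := by
  have h0 : poincare {(0 : ℂ)} = 0 := by
    unfold poincare
    rw [withDensity_apply _ (measurableSet_singleton 0), Measure.restrict_restrict
      (measurableSet_singleton 0)]
    refine setLIntegral_measure_zero _ _ ?_
    exact measure_mono_null Set.inter_subset_left (measure_singleton 0)
  have h : nu haarCircle (orbit ⁻¹' {(0 : ℂ)}) = 0 := by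
    rw [← Measure.map_apply continuous_orbit.measurable (measurableSet_singleton 0), map_orbit_nu,
      Measure.smul_apply, h0, smul_zero]
  exact h

/-- **Almost every `g` has `g·0 ≠ 0`.** -/
theorem orbit_ne_zero_ae : ∀ᵐ g ∂(nu haarCircle), orbit g ≠ 0 := by
  rw [ae_iff]
  simpa only [not_not] using nu_orbit_eq_zero

/-- The open set `{g·0 ≠ 0}` has positive Haar measure (it contains `a_1`). -/
theorem nu_orbit_ne_zero_pos : 0 < nu haarCircle {g : SU11 | orbit g ≠ 0} := by
  have hopen : IsOpen {g : SU11 | orbit g ≠ 0} := isOpen_ne_fun continuous_orbit continuous_const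
  refine hopen.measure_pos (nu haarCircle) ⟨hyp 1, ?_⟩
  simp only [mem_setOf_eq, orbit_hyp, ne_eq, Complex.ofReal_eq_zero]
  rw [Real.tanh_eq_sinh_div_cosh]
  exact div_ne_zero (Real.sinh_pos_iff.mpr one_pos).ne' (Real.cosh_pos 1).ne'

/-! ### Antitone in the weight -/

/-- **The Jacobi transform is antitone in the weight**: `k₁ ≤ k₂ ⇒ m̂_{k₂}(λ) ≤ m̂_{k₁}(λ)`. -/
theorem jacobi_weight_le {lam k₁ k₂ : ℝ} (hk : 1 < k₁) (h1 : lam < k₁) (h2 : 2 < k₁ + lam)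
    (h : k₁ ≤ k₂) :
    ∫ g, (1 - ‖orbit g‖ ^ 2) ^ (k₂ / 2) * sph lam g ∂(nu haarCircle)
      ≤ ∫ g, (1 - ‖orbit g‖ ^ 2) ^ (k₁ / 2) * sph lam g ∂(nu haarCircle) :=
  integral_mono (integrable_orbit_rpow_mul_sph (by linarith) (by linarith) (by linarith))
    (integrable_orbit_rpow_mul_sph hk h1 h2) fun g =>
    mul_le_mul_of_nonneg_right (orbit_rpow_antitone h g) (sph_pos lam g).le

/-- `AntitoneOn` form, on the ray `k > max(1, λ, 2 − λ)`. -/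
theorem antitoneOn_jacobi_weight (lam : ℝ) :
    AntitoneOn (fun k => ∫ g, (1 - ‖orbit g‖ ^ 2) ^ (k / 2) * sph lam g ∂(nu haarCircle))
      (Ioi (max 1 (max lam (2 - lam)))) := by
  intro k₁ hk₁ k₂ _ h
  rw [mem_Ioi, max_lt_iff, max_lt_iff] at hk₁
  exact jacobi_weight_le hk₁.1 hk₁.2.1 (by linarith [hk₁.2.2]) h

/-- **Strictly antitone**: `k₁ < k₂ ⇒ m̂_{k₂}(λ) < m̂_{k₁}(λ)` (the difference of the integrands is
positive on `{g·0 ≠ 0}`, an open set of positive measure). -/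
theorem jacobi_weight_lt {lam k₁ k₂ : ℝ} (hk : 1 < k₁) (h1 : lam < k₁) (h2 : 2 < k₁ + lam)
    (h : k₁ < k₂) :
    ∫ g, (1 - ‖orbit g‖ ^ 2) ^ (k₂ / 2) * sph lam g ∂(nu haarCircle)
      < ∫ g, (1 - ‖orbit g‖ ^ 2) ^ (k₁ / 2) * sph lam g ∂(nu haarCircle) := by
  have hi1 := integrable_orbit_rpow_mul_sph hk h1 h2
  have hi2 : Integrable (fun g => (1 - ‖orbit g‖ ^ 2) ^ (k₂ / 2) * sph lam g) (nu haarCircle) :=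
    integrable_orbit_rpow_mul_sph (by linarith) (by linarith) (by linarith)
  have hd : Integrable (fun g => (1 - ‖orbit g‖ ^ 2) ^ (k₁ / 2) * sph lam g
      - (1 - ‖orbit g‖ ^ 2) ^ (k₂ / 2) * sph lam g) (nu haarCircle) := hi1.sub hi2
  have hnn : 0 ≤ fun g => (1 - ‖orbit g‖ ^ 2) ^ (k₁ / 2) * sph lam g
      - (1 - ‖orbit g‖ ^ 2) ^ (k₂ / 2) * sph lam g := fun g =>
    sub_nonneg.mpr (mul_le_mul_of_nonneg_right (orbit_rpow_antitone h.le g) (sph_pos lam g).le)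
  have hpos : 0 < ∫ g, ((1 - ‖orbit g‖ ^ 2) ^ (k₁ / 2) * sph lam g
      - (1 - ‖orbit g‖ ^ 2) ^ (k₂ / 2) * sph lam g) ∂(nu haarCircle) := by
    rw [integral_pos_iff_support_of_nonneg hnn hd]
    refine lt_of_lt_of_le nu_orbit_ne_zero_pos (measure_mono fun g hg => ?_)
    simp only [mem_setOf_eq] at hg
    simp only [Function.mem_support, ne_eq]
    exact (sub_pos.mpr (mul_lt_mul_of_pos_right (orbit_rpow_strictAnti h hg) (sph_pos lam g))).ne'
  rw [integral_sub hi1 hi2] at hpos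
  linarith

/-- `StrictAntiOn` form, on the ray `k > max(1, λ, 2 − λ)`. -/
theorem strictAntiOn_jacobi_weight (lam : ℝ) :
    StrictAntiOn (fun k => ∫ g, (1 - ‖orbit g‖ ^ 2) ^ (k / 2) * sph lam g ∂(nu haarCircle))
      (Ioi (max 1 (max lam (2 - lam)))) := by
  intro k₁ hk₁ k₂ _ h
  rw [mem_Ioi, max_lt_iff, max_lt_iff] at hk₁
  exact jacobi_weight_lt hk₁.1 hk₁.2.1 (by linarith [hk₁.2.2]) h

/-! ### Log-convex in the weight (Hölder) -/

/-- **Hölder**: `m̂_{a k₁ + b k₂}(λ) ≤ m̂_{k₁}(λ)^a · m̂_{k₂}(λ)^b` for `a, b > 0`, `a + b = 1`, `k₁, k₂` on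
the ray — the multiplicative form of the log-convexity in the weight. -/
theorem jacobi_mul_add_mul_le {lam k₁ k₂ a b : ℝ} (hk₁ : 1 < k₁) (h11 : lam < k₁) (h12 : 2 < k₁ + lam)
    (hk₂ : 1 < k₂) (h21 : lam < k₂) (h22 : 2 < k₂ + lam) (ha : 0 < a) (hb : 0 < b) (hab : a + b = 1) :
    ∫ g, (1 - ‖orbit g‖ ^ 2) ^ ((a * k₁ + b * k₂) / 2) * sph lam g ∂(nu haarCircle)
      ≤ (∫ g, (1 - ‖orbit g‖ ^ 2) ^ (k₁ / 2) * sph lam g ∂(nu haarCircle)) ^ a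
        * (∫ g, (1 - ‖orbit g‖ ^ 2) ^ (k₂ / 2) * sph lam g ∂(nu haarCircle)) ^ b := by
  -- the Hölder factors `F c k g = (m_k(g) φ_λ(g))^c`
  set F : ℝ → ℝ → SU11 → ℝ := fun c k g => ((1 - ‖orbit g‖ ^ 2) ^ (k / 2) * sph lam g) ^ c with hF
  have e : Real.HolderConjugate (1 / a) (1 / b) := Real.holderConjugate_one_div ha hb hab
  have posF : ∀ c k g, 0 ≤ F c k g := fun c k g =>
    Real.rpow_nonneg (mul_nonneg (orbit_rpow_nonneg k g) (sph_pos lam g).le) _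
  have posF' : ∀ c k, 0 ≤ᵐ[nu haarCircle] F c k := fun c k => Filter.Eventually.of_forall (posF c k)
  have Fpow : ∀ {c : ℝ}, 0 < c → ∀ (k : ℝ) (g : SU11),
      F c k g ^ (1 / c) = (1 - ‖orbit g‖ ^ 2) ^ (k / 2) * sph lam g := by
    intro c hc k g
    simp only [hF]
    rw [← Real.rpow_mul (mul_nonneg (orbit_rpow_nonneg k g) (sph_pos lam g).le),
      mul_one_div_cancel hc.ne', Real.rpow_one]
  have contF : ∀ {c : ℝ}, 0 ≤ c → ∀ k : ℝ, Continuous (F c k) := fun hc k =>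
    ((continuous_orbit_rpow k).mul (continuous_sph lam)).rpow_const fun _ => Or.inr hc
  have memLp : ∀ {c k : ℝ}, 0 < c → 1 < k → lam < k → 2 < k + lam →
      MemLp (F c k) (ENNReal.ofReal (1 / c)) (nu haarCircle) := by
    intro c k hc hk h1 h2
    have A : ENNReal.ofReal (1 / c) ≠ 0 := by
      rwa [Ne, ENNReal.ofReal_eq_zero, not_le, one_div_pos]
    have B : ENNReal.ofReal (1 / c) ≠ ∞ := ENNReal.ofReal_ne_top
    rw [← memLp_norm_rpow_iff (contF hc.le k).aestronglyMeasurable A B,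
      ENNReal.toReal_ofReal (one_div_nonneg.mpr hc.le), ENNReal.div_self A B,
      memLp_one_iff_integrable]
    refine (integrable_orbit_rpow_mul_sph hk h1 h2).congr (Filter.Eventually.of_forall fun g => ?_)
    show (1 - ‖orbit g‖ ^ 2) ^ (k / 2) * sph lam g = ‖F c k g‖ ^ (1 / c)
    rw [Real.norm_of_nonneg (posF c k g), Fpow hc k g]
  -- the product of the factors is the integrand of the intermediate weight
  have hprod : ∀ g, (1 - ‖orbit g‖ ^ 2) ^ ((a * k₁ + b * k₂) / 2) * sph lam g
      = F a k₁ g * F b k₂ g := by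
    intro g
    have hx : 0 < 1 - ‖orbit g‖ ^ 2 := one_sub_norm_orbit_sq_pos g
    have hs : 0 < sph lam g := sph_pos lam g
    have e1 : F a k₁ g = (1 - ‖orbit g‖ ^ 2) ^ (k₁ / 2 * a) * sph lam g ^ a := by
      simp only [hF]
      rw [Real.mul_rpow (Real.rpow_nonneg hx.le _) hs.le, ← Real.rpow_mul hx.le]
    have e2 : F b k₂ g = (1 - ‖orbit g‖ ^ 2) ^ (k₂ / 2 * b) * sph lam g ^ b := by
      simp only [hF]
      rw [Real.mul_rpow (Real.rpow_nonneg hx.le _) hs.le, ← Real.rpow_mul hx.le]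
    rw [e1, e2, mul_mul_mul_comm, ← Real.rpow_add hx, ← Real.rpow_add hs, hab, Real.rpow_one]
    congr 2
    ring
  have key := MeasureTheory.integral_mul_le_Lp_mul_Lq_of_nonneg e (posF' a k₁) (posF' b k₂)
    (memLp ha hk₁ h11 h12) (memLp hb hk₂ h21 h22)
  rw [one_div_one_div, one_div_one_div] at key
  simp_rw [Fpow ha k₁, Fpow hb k₂] at key
  simp_rw [hprod]
  exact key

/-- **THE JACOBI TRANSFORM IS LOG-CONVEX IN THE WEIGHT** on the ray `k > max(1, λ, 2 − λ)`. -/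
theorem convexOn_log_jacobi_weight (lam : ℝ) :
    ConvexOn ℝ (Ioi (max 1 (max lam (2 - lam))))
      (fun k => Real.log (∫ g, (1 - ‖orbit g‖ ^ 2) ^ (k / 2) * sph lam g ∂(nu haarCircle))) := by
  refine convexOn_iff_forall_pos.mpr ⟨convex_Ioi _, fun x hx y hy a b ha hb hab => ?_⟩
  rw [mem_Ioi, max_lt_iff, max_lt_iff] at hx hy
  simp only [smul_eq_mul]
  have hxpos := jacobi_pos hx.1 hx.2.1 (by linarith [hx.2.2])
  have hypos := jacobi_pos hy.1 hy.2.1 (by linarith [hy.2.2])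
  rw [← Real.log_rpow hxpos, ← Real.log_rpow hypos,
    ← Real.log_mul (Real.rpow_pos_of_pos hxpos a).ne' (Real.rpow_pos_of_pos hypos b).ne']
  have hzpos : 0 < ∫ g, (1 - ‖orbit g‖ ^ 2) ^ ((a * x + b * y) / 2) * sph lam g ∂(nu haarCircle) :=
    jacobi_pos (by nlinarith) (by nlinarith) (by nlinarith)
  exact Real.log_le_log hzpos
    (jacobi_mul_add_mul_le hx.1 hx.2.1 (by linarith [hx.2.2]) hy.1 hy.2.1 (by linarith [hy.2.2]) ha hb hab)

/-! ### `k → ∞` -/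

/-- **`m̂_k(λ) → 0` as `k → ∞`** (dominated convergence; the integrands tend to `0` off the null set
`K`). -/
theorem tendsto_jacobi_weight_atTop_zero (lam : ℝ) :
    Tendsto (fun k : ℝ => ∫ g, (1 - ‖orbit g‖ ^ 2) ^ (k / 2) * sph lam g ∂(nu haarCircle)) atTop
      (𝓝 0) := by
  set k₀ : ℝ := max 1 (max lam (2 - lam)) + 1 with hk₀
  have hk₀1 : 1 < k₀ := by
    have := le_max_left (1 : ℝ) (max lam (2 - lam))
    linarith
  have hk₀2 : lam < k₀ := by
    have := le_max_right (1 : ℝ) (max lam (2 - lam))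
    have := le_max_left lam (2 - lam)
    linarith
  have hk₀3 : 2 < k₀ + lam := by
    have := le_max_right (1 : ℝ) (max lam (2 - lam))
    have := le_max_right lam (2 - lam)
    linarith
  have hbound := integrable_orbit_rpow_mul_sph hk₀1 hk₀2 hk₀3
  have h0 : (0 : ℝ) = ∫ g, (0 : ℝ) ∂(nu haarCircle) := by simp
  rw [h0]
  refine tendsto_integral_filter_of_dominated_convergence
    (fun g => (1 - ‖orbit g‖ ^ 2) ^ (k₀ / 2) * sph lam g) ?_ ?_ hbound ?_
  · refine Filter.Eventually.of_forall fun k => ?_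
    have hc : Continuous fun g : SU11 => (1 - ‖orbit g‖ ^ 2) ^ (k / 2) * sph lam g :=
      (continuous_orbit_rpow k).mul (continuous_sph lam)
    exact hc.aestronglyMeasurable
  · filter_upwards [eventually_ge_atTop k₀] with k hk
    refine Filter.Eventually.of_forall fun g => ?_
    rw [Real.norm_of_nonneg (mul_nonneg (orbit_rpow_nonneg k g) (sph_pos lam g).le)]
    exact mul_le_mul_of_nonneg_right (orbit_rpow_antitone hk g) (sph_pos lam g).le
  · filter_upwards [orbit_ne_zero_ae] with g hg
    have hx : 0 < 1 - ‖orbit g‖ ^ 2 := one_sub_norm_orbit_sq_pos g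
    have hlt : 1 - ‖orbit g‖ ^ 2 < 1 := by
      have := norm_pos_iff.mpr hg
      nlinarith
    have h1 : Tendsto (fun k : ℝ => (1 - ‖orbit g‖ ^ 2) ^ (k / 2)) atTop (𝓝 0) :=
      (tendsto_rpow_atTop_of_base_lt_one _ (by linarith) hlt).comp
        (tendsto_id.atTop_div_const two_pos)
    simpa using h1.mul_const (sph lam g)

end measure

end Summit.Ventures.HodgeRepro2.T5SU11JacobiWeight
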